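import Summits.QuantumFields.YangMills.Theorems.BalabanUVNodesN13Cor3AsymJunctionThm2KeyedAtBgRegFullBudgetAtRecord13CoPH

/-!
# BalabanUVNodes ∕ N13 — THE N11 → N13 EDGE END AT NODE 00's STAGE-13 RECORD, part 4: THE TWO β-ROWS OF THE END (`β_j ≥ 0` of [III] (2.43), couplings `≥ 0`) READ FROM
# NODE O's SIGN LETTER `FlowStep.BetaLowerH 0 γ (betaOfRecord₁₃ …)` AND THE RUN's WINDOW `Step.InInterval γ K (gOfRecord₁₃ …)` via (0.20)
# (Track A, DAG node N13 = [B16]; cluster K1 — K1⁷ `StabilityBAtRecordR13SepCoPH` = stmt-QuantumFields-20542, helper `--as helper`; seat `pub-ymgap-dag-n13-w2` g3, own-lineage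
# successor of part 3 `…Thm2KeyedAtBgRegFullBudgetAtRecord13CoPH`; 2026-08-28; count-neutral)

[I] = [Balaban1987RG1] (0.18)–(0.20) pp. 255–256, §1 p. 264 (β-function properties deferred); [III] = [Balaban1988Convergent] Thm 2 p. 263, (2.6)–(2.8) p. 255, p. 264;
[B16] = [Balaban1989LargeFieldII] (0.1) p. 356, p. 387 ll. 21–27.
statement-level bookkeeping of a published proof with citation tags; proofs kernel-checked; nothing here is a claim about the Yang–Mills mass gap

CITATION HEADER (verbatim, text layer).  [III] p. 263, under (2.43): *"for β < 1, and sufficiently regular configurations U_k = U_k(V)"* — the `β_j = g_{j−1}⁻² − g_j⁻²` entering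
(2.43) through «−β_j A(φ, U_k)» are the steps of the recursion [I] (0.20); p. 264: *"Corollary 3 (Ultraviolet Stability). Under the assumptions of Theorem 1 there exist constants
E₋, E₊ independent of η and T, but depending on g_k, such that"* (2.50).

WHY THIS FILE.  Every N11 → N13 END of this lineage (p601758 §3, p606459, p607455, p609885) displays `hβj : ∀ j ≤ k, 0 ≤ 1∕g_{j−1}² − 1∕g_j²` (the sign used to compare
the smeared and the full Wilson action in (2.43)'s sum — the DAG's unprinted `betaPositive` leaf) and `hg : g_j ≥ 0`.  At the record the history IS generated,
`gOfRecord₁₃ F N θ P = genSeq (betaOfRecord₁₃ F N θ) P.g0` (definitional), and (0.20) reads `g_{m+1}⁻² = g_m⁻² − β_m(g₀,…,g_m)` in the window (`Node00.inv_sq_genSeq_succ`); so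
`hβj` IS «`β₁₃ ≥ 0` at the run's prefixes», i.e. NODE O's sign box `FlowStep.BetaLowerH 0 γ β₁₃` restricted to a windowed run (K0a's `B15Claim189N0OfRecord.betaAlongHistory_nonneg_of_betaLowerH`),
and `hg` IS the window.  THIS FILE makes the two substitutions in part 3's END, so that its β-side reads the SAME two letters the K1 engine's world carries (n24-c Parts 26–27:
NODE O read as a sign pays v6's partial-sum floor; here it pays Theorem 2's `β_j ≥ 0`).

WHAT THIS FILE PROVES (2 theorems, 0 `def`, 0 `sorry`; BY NAME over part 3, `Node00.inv_sq_genSeq_succ`, `B15Claim189N0OfRecord.betaAlongHistory_nonneg_of_betaLowerH`).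
§0 `inv_sq_sub_nonneg_of_betaSign_of_inInterval` (generic `HBeta`, generated history in a window) · §1 ★★★ `uvIneq_at_record₁₃CoPH_of_thm2Supply_chainWitness_atBgReg_of_betaSign_window_of_fullBudget`.

HONEST SCOPE ∕ A6.  By-name junction, count-neutral; the SIGN of `β₁₃` on the window box is NODE O's unprinted asymptotic-freedom content ([I] p. 264 defers the β-function
properties; [II] (2.41); cell T09.F) — a HYPOTHESIS, never asserted (inhabited at no θ in the tree); LOCATED as parts 1–3 (`hH` no supplier; `hA'eq` ∕ `hφ1` identification rows;
`hreg` = [15]); Theorem 2's supply tokens, the obligations, (1.79)∕(1.80)∕(1.80)⁺, the (1.90) gas stay HYPOTHESES; nothing of Bałaban's asserted; N11 ∕ N13 NOT discharged;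
K0⁷ ∕ K1⁷ NOT closed (`stub_nodes13PWS` ∕ `stub_runRows13PWS` NOT proved); counts UNMOVED (discharged 5∕27 · Track A 5∕28); one finite `𝕋⁴_{L^K}` programme at fixed
`ε = L^{−K}`, Bałaban AS PRINTED; R4 closes the conditional finite-𝕋⁴ rung `BalabanLadder.UV` only — the Yang–Mills mass gap (Clay) is NOT proved by any of this; nothing
continuum ∕ ℝ⁴ ∕ OS.  No `def`, no `sorry`, no `instance`, no `notation`. -/

noncomputable section

open MeasureTheory
open scoped BigOperators Matrix.Norms.L2Operator

namespace Summit.QuantumFields.YangMills.BalabanUVNodes.N13Cor3AsymJunctionThm2KeyedAtBgRegWindowSignFullBudgetAtRecord13CoPH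

open Literature.MathematicalPhysics.QuantumFieldTheory.Balaban1983to89 Step B14.Eq225Concrete B14.LocalCoupling B14Thm2 Finset
open T4Continuum T4DatumAssembly Node00 DagBinding FlowStepRuns B15DeterminingSets
open B10Eq38TorusDomains (toFine)
open B16Cor3Ops (PosOp Repr172)
open TreeLengthTorus (tsys proj TPt TAdj)
open B13FamilySum (Ineq126 VolBound)
open B16Eq190Resummation (bracket mayerTerm F191 polys190 LocalOps DepOn)
open B13ScaleTransfer (Pt FaceConnected)
open TreeLength (treeLen)
open B16SProfile (Sop)
open B13Factor210Literal (fineCubes)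
open Summit.QuantumFields.YangMills.Theorems.BalabanUVNodesN11Sect3SupplyChainDefs (Sect3Supplier chainWitness)
open Summit.QuantumFields.YangMills.Theorems.BalabanUVNodesN11Sect3SupplyChainObligationsDefs (SupplierObligations NoExpansionObligation ChainFormAt
  chainFormAt_all_of_obligations)
open Summit.QuantumFields.YangMills.Theorems.BalabanUVNodesN11Thm2Sect2DataOfRecordKeyedDefs (sect2DataOfRecord₁₃Keyed)
open Summit.QuantumFields.YangMills.Theorems.BalabanUVNodesN11Thm2AlongSupplyChain (h248_chainWitness_of_chainFormAt)

open Summit.QuantumFields.YangMills.Theorems.BalabanUVNodesN11Thm2SupplyDefs (Thm2ESupplyAt Thm2RSupplyAt ineq243_keyed_of_eSupply ineq244_keyed_of_rSupply)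
open FlowStep (HBeta prefixOf BetaLowerH)
open Summit.QuantumFields.YangMills.BalabanUVNodes.N13Cor3AsymJunctionThm2KeyedAtBgRegFullBudgetAtRecord13CoPH (uvIneq_at_record₁₃CoPH_of_thm2Supply_chainWitness_atBgReg_of_fullBudget)

/-! ## §0. Along a generated history in a window, the sign of β IS the monotonicity of the inverse couplings -/

/-- **`0 ≤ g_{j−1}⁻² − g_j⁻²` (1 ≤ j ≤ n) ALONG THE GENERATED HISTORY `genSeq β g₀` IN THE WINDOW `]0, γ]` UP TO `n`, WHEN `β ≥ 0` ON THE γ-BOX**: one step of (0.20),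
`g_j⁻² = g_{j−1}⁻² − β_{j−1}(g₀,…,g_{j−1})` (`Node00.inv_sq_genSeq_succ`, needs `0 < g_j` — the window), and `β_{j−1} ≥ 0` at the prefix (in the box by the window,
`B15Claim189N0OfRecord.betaAlongHistory_nonneg_of_betaLowerH`).  Generic `HBeta`; the sign is a HYPOTHESIS. [cite: Balaban1987RG1, (0.18)–(0.20) pp.255–256, §1 p.264; Balaban1988Convergent, (2.6) p.255] -/
theorem inv_sq_sub_nonneg_of_betaSign_of_inInterval (β : HBeta) (g0 : ℝ) {γ : ℝ} {n : ℕ} (hsign : BetaLowerH 0 γ β)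
    (hI : Step.InInterval γ n (genSeq β g0)) :
    ∀ j, 1 ≤ j → j ≤ n → 0 ≤ 1 / genSeq β g0 (j - 1) ^ 2 - 1 / genSeq β g0 j ^ 2 := by
  intro j hj hjn
  obtain ⟨m, rfl⟩ : ∃ m, j = m + 1 := ⟨j - 1, by omega⟩
  have hpos : 0 < genSeq β g0 (m + 1) := (hI (m + 1) hjn).1
  have hstep := Node00.inv_sq_genSeq_succ β g0 hpos
  have hβ := B15Claim189N0OfRecord.betaAlongHistory_nonneg_of_betaLowerH le_rfl hsign hI m (by omega)
  simp only [Nat.add_sub_cancel, one_div]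
  linarith

/-! ## §1. Part 3's END at `bgReg` with the two β-rows read from the sign letter and the window -/

section SignWindowEnd

variable (F : T4Family) (N : ℕ) [NeZero N]
variable (θ : Stage13HParams F N) (h : θ.Provisos₁₃CoPH F N) (P : B12.RunParams) (k : ℕ)

open Classical in
/-- **★★★ (UV₁₃) AT LEVEL `k ≤ K` OF THE RUN `P` AT NODE 00's STAGE-13 RECORD — part 3's supply ∕ chain END AT `bgReg` WITH THE TWO β-ROWS READ FROM NODE O's SIGN LETTER AND
THE WINDOW**: `uvIneq_at_record₁₃CoPH_of_thm2Supply_chainWitness_atBgReg_of_fullBudget` with `hg : g_j ≥ 0 (j ≤ K)` := the window `hI : Step.InInterval γ P.K (gOfRecord₁₃ …)`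
(`0 < g_j ≤ γ`) and `hβj : 0 ≤ 1∕g_{j−1}² − 1∕g_j² (1 ≤ j ≤ k)` := §0 at `β := betaOfRecord₁₃ F N θ`, `g₀ := P.g0` (`gOfRecord₁₃ = genSeq β₁₃ g₀` definitionally) from the SIGN
`hsign : FlowStep.BetaLowerH 0 γ (betaOfRecord₁₃ …)` — NODE O's unprinted AF letter in the currency the K0 ∕ nodeO lanes and the K1 engine carry (n24-c's `hsignF`; [I] p. 264,
[II] (2.41)).  Everything else VERBATIM from part 3 §2 (supply tokens on `bgReg`, `hreg`, `(hσ, hT)`, `hk`, the V-indexed history ∕ volumes ∕ seam `hA'eq`, `hφ ∕ hφ1`, (2.46)'s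
inputs, vacuum, log sizes, budget data, (1.90) gas, `hH`).  CONDITIONAL on every input — LOCATED as parts 1–3; the sign letter is a HYPOTHESIS, never asserted; nothing of Bałaban's
asserted; N11 ∕ N13 NOT discharged; count-neutral.
[cite: Balaban1987RG1, (0.18)–(0.20) pp.255–256, §1 p.264; Balaban1988Convergent, Thm 2 (2.43) p.263, (2.45)–(2.50) pp.263–264, (3.65)–(3.67) p.283; Balaban1989LargeFieldII, (0.1) p.356, (1.72) p.379, p.387 ll.21–27] -/
theorem uvIneq_at_record₁₃CoPH_of_thm2Supply_chainWitness_atBgReg_of_betaSign_window_of_fullBudget (Nc : ℕ) [NeZero Nc] (R : Repr172 (GaugeField (F.P P.K) k (SU N)) (tsys 4 Nc).Dom)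
    {M₁ : ℝ} (hM : M₁ ≠ 0) (hnum : (Fintype.card (Site (F.P P.K) k) : ℝ) = (M₁ * Nc) ^ 4)
    {κ₁ : ℝ} (hκ : B12TreeDecay.kappa₀ (4 * 2 ^ 4) (2 * 4) ≤ κ₁) (hκ₁ : 0 ≤ κ₁) (c₀ : ℝ)
    (hH : R.Holds (densOfRecord₁₃ F N θ.toStage13Params P k))
    (hχ01 : ∀ a V, 0 ≤ R.χ a V ∧ R.χ a V ≤ 1)
    (h0χ : ∀ V, R.χ R.allSmall V = chiβOfRecord₁₃ F N θ.toStage13Params P.K (gOfRecord₁₃ F N θ.toStage13Params P) k V)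
    -- the components of `Z_k`: composite structure and per-component (1.79)/(1.80) data
    (T : R.Adm → (tsys 4 Nc).Dom → PosOp (GaugeField (F.P P.K) k (SU N))) (l : R.Adm → List (tsys 4 Nc).Dom)
    (hnd : ∀ a, (l a).Nodup) (hset : ∀ a, (l a).toFinset = R.Zc a)
    (hTZ : ∀ a Fn V, (R.TZ a).T Fn V = (PosOp.pi (T a) (l a)).T Fn V)
    (b : Step.Budget.Consts) (Lb : ℝ) {Rk q : ℕ} (hRk : 0 < Rk) (hq : 0 < q)
    (hC : 0 ≤ b.C) (hbM : 0 ≤ b.M) (hRm : ∀ m, 0 ≤ b.R m) (hdim : b.d = 4) (hRq : ((Rk * q : ℕ) : ℝ) = Lb * b.R (k + 1)) (hLb : 0 ≤ Lb)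
    (hslope2 : 2 * (κ₁ * (4 * 2 ^ 4) * Lb ^ b.d) ≤ b.C * b.M ^ b.d * b.R (k + 1))
    (X₀ : R.Adm → (tsys 4 Nc).Dom → Finset (Pt 4)) (K : R.Adm → (tsys 4 Nc).Dom → ℕ)
    (κ Pp : R.Adm → (tsys 4 Nc).Dom → ℝ) (s : R.Adm → (tsys 4 Nc).Dom → ℕ → ℝ)
    (hdataZ : ∀ a, ∀ X ∈ R.Zc a, (X₀ a X).Nonempty ∧ FaceConnected (X₀ a X) ∧
      X.1 = (fineCubes Rk (X₀ a X)).image (proj Nc) ∧ 1 ≤ K a X ∧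
      (∀ V, (T a X).T 1 V ≤ Real.exp (-(κ a X) - Pp a X)) ∧ Step.Budget.Controls b k (K a X) (κ a X) (s a X) ∧
      (∀ m, 0 ≤ s a X m) ∧ s a X (k + 1) = treeLen (Sop q (X₀ a X)) ∧ c₀ ≤ Pp a X)
    -- the domains `Y_i`: composite structure and per-domain (1.80)⁺ horizon-0 data
    (TY : R.Adm → (tsys 4 Nc).Dom → PosOp (GaugeField (F.P P.K) k (SU N))) (lY : R.Adm → List (tsys 4 Nc).Dom)
    (hndY : ∀ a, (lY a).Nodup) (hsetY : ∀ a, (lY a).toFinset = R.Ys a)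
    (hTYs : ∀ a Fn V, (R.TYs a).T Fn V = (PosOp.pi (TY a) (lY a)).T Fn V)
    (SY : R.Adm → (tsys 4 Nc).Dom → Finset (Pt 4)) (κY PY : R.Adm → (tsys 4 Nc).Dom → ℝ) (sY : R.Adm → (tsys 4 Nc).Dom → ℕ → ℝ)
    (hdataY : ∀ a, ∀ Y ∈ R.Ys a, (SY a Y).Nonempty ∧ FaceConnected (SY a Y) ∧
      Y.1 = (fineCubes Rk (SY a Y)).image (proj Nc) ∧ (∀ V, (TY a Y).T 1 V ≤ Real.exp (-(κY a Y) - PY a Y)) ∧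
      Step.Budget.Controls b k 0 (κY a Y - κ₁ * treeLen (fineCubes Rk (SY a Y))) (sY a Y) ∧ c₀ ≤ PY a Y)
    -- the (1.90) gas of every admissible term (verbatim)
    {LF DomY Cube Var Sv : Type*} [Fintype LF] [Fintype DomY] [Fintype Cube] [DecidableEq LF] [DecidableEq DomY]
    [DecidableEq Cube] {adjC : Cube → Cube → Prop} [DecidableRel adjC]
    (hrefl : ∀ a, adjC a a) (hsymm : ∀ a b, adjC a b → adjC b a)
    {locX : LF → Finset Cube} {locY : DomY → Finset Cube} {site : Var → Cube} (Yfix : R.Adm → Finset Cube)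
    (houtX : ∀ a j, (locX j \ Yfix a).Nonempty) (houtY : ∀ a Y, (locY Y \ Yfix a).Nonempty)
    (Op : R.Adm → Finset LF → ((Var → Sv) → ℂ) →+ ((Var → Sv) → ℂ))
    (hOps : ∀ a, LocalOps adjC locX (Yfix a) site (Op a))
    (hOpReal : ∀ a (S : Finset LF) (f : (Var → Sv) → ℂ), (∀ ψ, (f ψ).im = 0) → ∀ φ, (Op a S f φ).im = 0)
    (Vt : R.Adm → DomY → (Var → Sv) → ℂ) (hV : ∀ a Y, DepOn (Yfix a) site (Vt a Y) (locY Y))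
    (hVreal : ∀ a Y ψ, (Vt a Y ψ).im = 0) (cfg : GaugeField (F.P P.K) k (SU N) → (Var → Sv))
    {nbr : Cube → Finset Cube} (hnbr : ∀ a b, adjC a b → a ∈ nbr b) {νn : ℝ} (hν : ∀ b, ((nbr b).card : ℝ) ≤ νn)
    {d : R.Adm → Finset Cube → ℝ} {c₁ Rr κc K₀ cv τ : ℝ} (hd : ∀ a X, 0 ≤ d a X) (hc₁ : 0 ≤ c₁) (hK₀ : 0 ≤ K₀) (hτ : 0 ≤ τ)
    (h197 : ∀ a V X, ‖F191 adjC locX locY (Yfix a) (mayerTerm (Op a) (Vt a) (cfg V)) X‖ ≤ c₁ * Real.exp (-(Rr * d a X)))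
    (h126 : ∀ a, Ineq126 (polys190 adjC locX locY (Yfix a)) (fun X => X \ Yfix a) (d a) κc K₀)
    (hvol : ∀ a, VolBound (polys190 adjC locX locY (Yfix a)) (fun X => X \ Yfix a) (d a) cv)
    (hrate : κc + τ * cv ≤ Rr) (hsmall : c₁ * Real.exp (τ * cv) * K₀ * νn ≤ τ)
    (hjunction : ∀ a V, R.curly a V = (bracket (Op a) (Vt a) (cfg V)).re)
    {πc : ℝ} (hQ : (Fintype.card Cube : ℝ) ≤ πc * (Fintype.card (Site (F.P P.K) k) : ℝ))
    -- dag-n11-e's supply chain on the live-selector line and [III] §3's two SUPPLY TOKENS at the chain witness ON PRINT's CLASS `bgReg`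
    (σ : Sect3Supplier θ P)
    (hsel : θ.ppSel = ppSelLiveOfRecord F N θ.ν θ.τ9 (EOfRecord₁₃ F N θ.toStage13Params) (wOfRecord₉ F N θ.toStage9Params))
    (hθ : θ.Admissible F N) (hE₀ : 0 ≤ θ.s2.lf.E₀) (hB₀ : 0 ≤ θ.s2.lf.B₀) (hMτ : 1 ≤ θ.τ9.M)
    (hκd : B12TreeDecay.kappa₀ (4 * 2 ^ (F.P P.K).d) (2 * (F.P P.K).d) ≤ θ.s2.lf.κ)
    (hσ : SupplierObligations θ P σ) (hT : NoExpansionObligation θ P σ)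
    {bE cE κR cR : ℝ} {κ₀ : ℕ}
    (hES : Thm2ESupplyAt θ P (fun k s => (chainWitness θ P σ k).1 s) (fun k _ => bgReg F N P.K k θ.εbg) bE cE)
    (hRS : Thm2RSupplyAt θ P (fun k s => (chainWitness θ P σ k).1 s) (fun k _ => bgReg F N P.K k θ.εbg) κR cR κ₀)
    (hb1 : bE < 1) (hL : 1 < ((F.P P.K).L : ℝ)) (hκ7 : 7 ≤ κ₀)
    -- NODE O's SIGN of the record's β-functions on the window box, and the run's window (replacing the rows `hg` ∕ `hβj`)
    {γ : ℝ} (hsign : BetaLowerH 0 γ (betaOfRecord₁₃ F N θ.toStage13Params)) (hI : Step.InInterval γ P.K (gOfRecord₁₃ F N θ.toStage13Params P))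
    (hreg : ∀ k (s : SeqOfRecord F θ.ν θ.τ9.M (gOfRecord₁₃ F N θ.toStage13Params P) P.K k) (U : GaugeField (F.P P.K) 0 (SU N)), U ∈ bgReg F N P.K k θ.εbg →
      ∀ j, 1 ≤ j → j ≤ k → ∀ X, Sect2.admB (F.P P.K) θ.ν θ.τ9.M (gOfRecord₁₃ F N θ.toStage13Params P) s.Ω s.Λ j (Sect2.domSites (F.P P.K) θ.τ9.M j X) = true →
        Sect2.ofBackgroundC (ιSU N) U ∈ Sect2.spaceMS (settingOfRecord₁₃ F N θ.toStage13Params P) (θ.rzAt P s) θ.τ9.M j (Sect2.domSites (F.P P.K) θ.τ9.M j X) s.Ω)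
    (hk : k ≤ P.K)
    -- the configuration-indexed data READ THROUGH THE CARRIER: history, fluctuation argument, volumes (region and ring)
    (sV : (V : GaugeField (F.P P.K) k (SU N)) → SeqOfRecord F θ.ν θ.τ9.M (gOfRecord₁₃ F N θ.toStage13Params P) P.K k)
    (aV : GaugeField (F.P P.K) k (SU N) → Tk.SFluct (F.P P.K) (FluctV N))
    (Ek EkLog EkRest : ℝ) (hEk : Ek = EkLog + EkRest) (E₂ : ℝ) (Γ : ℕ → ℝ)
    (hΓvol : ∀ V, ∀ n, 1 ≤ n → n ≤ k → ((univ.filter fun y : Site (F.P P.K) n => toFine n y ∈ gammaRegion (sV V).Ω k n).card : ℝ) ≤ Γ n)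
    (hΓr : ∀ V, ∀ n, 1 ≤ n → n ≤ k →
      ((univ.filter fun c : TPt (F.P P.K).d (Sect2.domCount (F.P P.K) θ.τ9.M n) =>
          (Sect2.domSites (F.P P.K) θ.τ9.M n (Sect2.cubeDom (F.P P.K) θ.τ9.M n c) ∩
              Sect2.enlT (F.P P.K) (Sect2.zSide (F.P P.K) θ.ν θ.τ9.M (gOfRecord₁₃ F N θ.toStage13Params P) n) 1 ((sV V).Λ n)ᶜ).Nonempty ∧
            ∃ c', (c' = c ∨ TAdj c' c) ∧ (Sect2.domSites (F.P P.K) θ.τ9.M n (Sect2.cubeDom (F.P P.K) θ.τ9.M n c') ∩ (sV V).Ω n).Nonempty).card : ℝ) ≤ Γ n)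
    (hφ : ∀ V, ∀ j, 1 ≤ j → j ≤ k → ∀ x, θ.Phih P k (sV V).Ω (sV V).Λ j x ≤ 1)
    (hφ1 : ∀ V, chiβOfRecord₁₃ F N θ.toStage13Params P.K (gOfRecord₁₃ F N θ.toStage13Params P) k V ≠ 0 →
      ∀ j, 1 ≤ j → j ≤ k → ∀ x, θ.Phih P k (sV V).Ω (sV V).Λ j x = 1)
    (hsum : ∀ n, 1 ≤ n → n ≤ k → ∑ j ∈ Icc 1 n, (gOfRecord₁₃ F N θ.toStage13Params P j) ^ κ₀ ≤ (gOfRecord₁₃ F N θ.toStage13Params P n) ^ (κ₀ - 6))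
    (hsmall6 : ∀ n, 1 ≤ n → n ≤ k →
      cR * B12TreeDecay.K₀ (4 * 2 ^ (F.P P.K).d) (2 * (F.P P.K).d) * (gOfRecord₁₃ F N θ.toStage13Params P n) ^ (κ₀ - 6) ≤ 1)
    (hvac : VacuumRestBound EkRest E₂ Γ k)
    (hA'eq : ∀ V, R.A' V =
      (sect2ActionDataOfRecord F N (FluctV N) P.K (settingOfRecord₁₃ F N θ.toStage13Params P) (θ.rzAt P (sV V)) (sV V)
        ((chainWitness θ P σ k).1 (sV V)) (aV V) Ek).action23 k (Uk F N P.K k θ.εbg V))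
    -- the sizes of the logarithmic vacuum term, the volume majorant, the sign of the `E₁`-free part of Theorem 2's constant
    {cΓ cL cL' : ℝ} (hrest : 0 ≤ 1 + 2 * (θ.s2.lf.B₀ * B12TreeDecay.K₀ (4 * 2 ^ (F.P P.K).d) (2 * (F.P P.K).d)) + E₂)
    (hΓ : ∑ n ∈ Icc 1 k, Γ n ≤ cΓ * (Fintype.card (Site (F.P P.K) k) : ℝ))
    (hlog : -(cL * (Fintype.card (Site (F.P P.K) k) : ℝ)) ≤ -EkLog)
    (hlog' : -EkLog ≤ cL' * (Fintype.card (Site (F.P P.K) k) : ℝ)) :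
    ∀ V : GaugeField (F.P P.K) k (SU N),
      B16.UVIneq ((datumOfRecord₁₃CoPH F N θ h).C P) k V
        ((cE * (1 - ((F.P P.K).L : ℝ) ^ (-(1 - bE)))⁻¹ + 1 + 2 * (θ.s2.lf.B₀ * B12TreeDecay.K₀ (4 * 2 ^ (F.P P.K).d) (2 * (F.P P.K).d)) + E₂) * cΓ + cL +
          πc * (c₁ * Real.exp (τ * cv) * K₀))
        ((cE * (1 - ((F.P P.K).L : ℝ) ^ (-(1 - bE)))⁻¹ + 1 + 2 * (θ.s2.lf.B₀ * B12TreeDecay.K₀ (4 * 2 ^ (F.P P.K).d) (2 * (F.P P.K).d)) + E₂) * cΓ + cL' +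
          πc * (c₁ * Real.exp (τ * cv) * K₀) + M₁⁻¹ ^ 4 * B12TreeDecay.K₀ (4 * 2 ^ 4) (2 * 4) * ∑ _i : Fin 2, Real.exp (-c₀)) :=
  uvIneq_at_record₁₃CoPH_of_thm2Supply_chainWitness_atBgReg_of_fullBudget F N θ h P k Nc R hM hnum hκ hκ₁ c₀ hH hχ01 h0χ T l hnd hset hTZ b Lb hRk hq hC
    hbM hRm hdim hRq hLb hslope2 X₀ K κ Pp s hdataZ TY lY hndY hsetY hTYs SY κY PY sY hdataY hrefl hsymm Yfix houtX houtY Op hOps hOpReal Vt hV hVreal cfg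
    hnbr hν hd hc₁ hK₀ hτ h197 h126 hvol hrate hsmall hjunction hQ σ hsel hθ hE₀ hB₀ hMτ hκd hσ hT hES hRS hb1 hL hκ7 (fun j hj => (hI j hj).1.le) hreg hk sV
    aV Ek EkLog EkRest hEk E₂ Γ hΓvol hΓr
    (fun j hj hjk => inv_sq_sub_nonneg_of_betaSign_of_inInterval (betaOfRecord₁₃ F N θ.toStage13Params) P.g0 hsign hI j hj (hjk.trans hk))
    hφ hφ1 hsum hsmall6 hvac hA'eq hrest hΓ hlog hlog'

end SignWindowEnd

end Summit.QuantumFields.YangMills.BalabanUVNodes.N13Cor3AsymJunctionThm2KeyedAtBgRegWindowSignFullBudgetAtRecord13CoPH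

end
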